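import Summits.HubbardSuperconductivity.HubbardSuperconductivity.Theorems.CooperPairDMottWalkBindingWalkNoPackageOnFour

/-!
# Route `CooperPairDMottWalk`, crux `BindingWalk` (stmt-HubbardSuperconductivity-1176):
# hidden symmetries of the BREATHING `4 × 4` torus — the weak-bond / strong-bond dichotomy

Helper file (`--supports stmt-HubbardSuperconductivity-1176`) for the registered line
`Cruxes/BindingWalk/Lines/birth.lean`, companion of `CooperPairDMottWalkBindingWalkNoPackageOnFour`.
There the three direction swaps of the hypercube `Q₄ = C₄ × C₄` kill the Cooper-pair package at the
PURE point of side `4`. Two of the hypercube swaps survive on the whole breathing family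
`H_4(a,b,U) = hamiltonian(intra) a U + hamiltonian(inter) b 0` (the route's `Hb 4 a b U`): the bit
swaps `g13` (`x`-inter ↔ `y`-inter directions) and `g24` (`x`-intra ↔ `y`-intra directions) are
automorphisms of BOTH the intra-plaquette and the inter-plaquette bond graphs (`decide`), for every
`a, b, U`. Consequence (**`breathing_four_dWave_bondClass_dichotomy`**, from the amplitude law
`dotProduct_mulVec_eq_of_fockRelabel_eigen` and `dWave_bondClass_dichotomy_of_relations`): whenever
the half-filled `(16, S^z=0)` floor and the two-hole `(14, S^z=0)` floor of `H_4(a,b,U)` are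
non-degenerate and the uniform `d_{x²-y²}` amplitude `⟨φ₂, Δ_d φ₀⟩` is nonzero, EITHER both
inter-plaquette ("weak bond") class amplitudes `⟨φ₂, D_{X₁} φ₀⟩, ⟨φ₂, D_{Y₁} φ₀⟩` vanish OR both
intra-plaquette ("strong bond") ones `⟨φ₂, D_{X₂} φ₀⟩, ⟨φ₂, D_{Y₂} φ₀⟩` do; under the route's
package at side `4` this applies to the floor vectors (`cooperPackage_breathing_four_bondClass_dichotomy`).
This is the exact, all-coupling form of the "puzzling" numerical observation of Tsai–Yao–Läuchli–
Kivelson (PRB 77 (2008) 214502, p. 5 and Fig. 7: `|Δ_w|/|Δ_s| ∼ 10⁻⁷` on the 4 × 4 checkerboard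
lattice for all `t′ < t`): the weak-bond pair amplitude is an exact zero forced by a hidden
symmetry of side `4`, not small physics — a second reason (with `not_cooperPackage_four`) why
`L = 4` exact diagonalisation of this family carries symmetry artefacts absent for `L ≥ 8`, where
`Aut(C_L × C_L)` is the ordinary space group. The statement `dWave_bondClass_dichotomy` is proved
for ANY Hamiltonian on the `4 × 4` torus invariant under `g13` and `g24` and any pair of
non-degenerate sector floors.

References: W.-F. Tsai, H. Yao, A. Läuchli, S. A. Kivelson, PRB 77 (2008) 214502, p. 5, Fig. 7;
G. Fano, F. Ortolani, A. Parola, PRB 42 (1990) 6877; D. J. Scalapino, Phys. Rep. 250 (1995) 329,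
§2. Finite combinatorics (`decide`) and linear algebra over tree theorems; no definition and no
named fact (site maps and bond classes are local notation, as in the companion file).
-/

set_option linter.dupNamespace false

noncomputable section

namespace Summit.HubbardSuperconductivity.HubbardSuperconductivity.Theorems.CooperPairDMottWalk

open Matrix Finset Literature.MathematicalPhysics.QuantumLattice Literature.Probability.LatticeModels
open Literature.MathematicalPhysics.QuantumLattice.PairChirality (bond)
open scoped ComplexOrder

/-! ### Algebra: the dichotomy from the two surviving swaps -/

/-- **Dichotomy by hand.** Four amplitudes transforming by scalars under the transpositions
`(1 3)` (scalar `κ`) and `(2 4)` (scalar `κ'`) of their indices, with non-vanishing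
`B₁`-combination `F₁ + F₂ - F₃ - F₄`, have `F₂ = F₄ = 0` or `F₁ = F₃ = 0`. [folklore] -/
theorem dWave_bondClass_dichotomy_of_relations {F₁ F₂ F₃ F₄ κ κ' : ℂ}
    (a1 : F₁ = κ * F₃) (a2 : F₂ = κ * F₂) (a4 : F₄ = κ * F₄)
    (b1 : F₁ = κ' * F₁) (b2 : F₂ = κ' * F₄) (b3 : F₃ = κ' * F₃)
    (hT : F₁ + F₂ - F₃ - F₄ ≠ 0) :
    (F₂ = 0 ∧ F₄ = 0) ∨ (F₁ = 0 ∧ F₃ = 0) := by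
  have fix : ∀ {F c : ℂ}, F = c * F → c ≠ 1 → F = 0 := by
    intro F c h hc
    have h' : (1 - c) * F = 0 := by rw [sub_mul, one_mul, sub_eq_zero]; exact h
    rcases mul_eq_zero.1 h' with h1 | h1
    · exact absurd (sub_eq_zero.1 h1).symm hc
    · exact h1
  by_cases hκ : κ = 1
  · subst hκ
    by_cases hκ' : κ' = 1
    · subst hκ'
      rw [one_mul] at a1 b2
      exact absurd (by rw [a1, b2]; ring) hT
    · exact Or.inr ⟨fix b1 hκ', fix b3 hκ'⟩
  · exact Or.inl ⟨fix a2 hκ, fix a4 hκ⟩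

/-! ### The side `4`: the two swaps surviving on the breathing family -/

section Breathing

/-- Ordered `x`-bonds between different plaquettes (hypercube direction `a₁`). -/
local notation "X₁" => (Finset.univ.filter fun p : FermionTorus 2 4 × FermionTorus 2 4 =>
  ofLex (Prod.fst p) 1 = ofLex (Prod.snd p) 1 ∧
    ((ofLex (Prod.fst p) 0 = 1 ∧ ofLex (Prod.snd p) 0 = 2) ∨ (ofLex (Prod.fst p) 0 = 2 ∧ ofLex (Prod.snd p) 0 = 1) ∨
     (ofLex (Prod.fst p) 0 = 3 ∧ ofLex (Prod.snd p) 0 = 0) ∨ (ofLex (Prod.fst p) 0 = 0 ∧ ofLex (Prod.snd p) 0 = 3)))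

/-- Ordered `x`-bonds inside the plaquettes (hypercube direction `a₂`). -/
local notation "X₂" => (Finset.univ.filter fun p : FermionTorus 2 4 × FermionTorus 2 4 =>
  ofLex (Prod.fst p) 1 = ofLex (Prod.snd p) 1 ∧
    ((ofLex (Prod.fst p) 0 = 0 ∧ ofLex (Prod.snd p) 0 = 1) ∨ (ofLex (Prod.fst p) 0 = 1 ∧ ofLex (Prod.snd p) 0 = 0) ∨
     (ofLex (Prod.fst p) 0 = 2 ∧ ofLex (Prod.snd p) 0 = 3) ∨ (ofLex (Prod.fst p) 0 = 3 ∧ ofLex (Prod.snd p) 0 = 2)))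

/-- Ordered `y`-bonds between different plaquettes (hypercube direction `b₁`). -/
local notation "Y₁" => (Finset.univ.filter fun p : FermionTorus 2 4 × FermionTorus 2 4 =>
  ofLex (Prod.fst p) 0 = ofLex (Prod.snd p) 0 ∧
    ((ofLex (Prod.fst p) 1 = 1 ∧ ofLex (Prod.snd p) 1 = 2) ∨ (ofLex (Prod.fst p) 1 = 2 ∧ ofLex (Prod.snd p) 1 = 1) ∨
     (ofLex (Prod.fst p) 1 = 3 ∧ ofLex (Prod.snd p) 1 = 0) ∨ (ofLex (Prod.fst p) 1 = 0 ∧ ofLex (Prod.snd p) 1 = 3)))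

/-- Ordered `y`-bonds inside the plaquettes (hypercube direction `b₂`). -/
local notation "Y₂" => (Finset.univ.filter fun p : FermionTorus 2 4 × FermionTorus 2 4 =>
  ofLex (Prod.fst p) 0 = ofLex (Prod.snd p) 0 ∧
    ((ofLex (Prod.fst p) 1 = 0 ∧ ofLex (Prod.snd p) 1 = 1) ∨ (ofLex (Prod.fst p) 1 = 1 ∧ ofLex (Prod.snd p) 1 = 0) ∨
     (ofLex (Prod.fst p) 1 = 2 ∧ ofLex (Prod.snd p) 1 = 3) ∨ (ofLex (Prod.fst p) 1 = 3 ∧ ofLex (Prod.snd p) 1 = 2)))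

/-- The bit swap `a₁ ↔ b₁` of the hypercube coordinates (`x`-inter ↔ `y`-inter directions), as a
site map of the `4 × 4` torus (table). -/
local notation "g13F" => (fun x : FermionTorus 2 4 => toLex
  ![(![![0, 0, 3, 3], ![1, 1, 2, 2], ![1, 1, 2, 2], ![0, 0, 3, 3]] : Fin 4 → Fin 4 → Fin 4)
      (ofLex x 0) (ofLex x 1),
    (![![0, 1, 1, 0], ![0, 1, 1, 0], ![3, 2, 2, 3], ![3, 2, 2, 3]] : Fin 4 → Fin 4 → Fin 4)
      (ofLex x 0) (ofLex x 1)])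

/-- The bit swap `a₂ ↔ b₂` (`x`-intra ↔ `y`-intra directions). -/
local notation "g24F" => (fun x : FermionTorus 2 4 => toLex
  ![(![![0, 1, 1, 0], ![0, 1, 1, 0], ![3, 2, 2, 3], ![3, 2, 2, 3]] : Fin 4 → Fin 4 → Fin 4)
      (ofLex x 0) (ofLex x 1),
    (![![0, 0, 3, 3], ![1, 1, 2, 2], ![1, 1, 2, 2], ![0, 0, 3, 3]] : Fin 4 → Fin 4 → Fin 4)
      (ofLex x 0) (ofLex x 1)])

/-- The plaquette-membership graph of the route (`x ∼ y` iff `x`, `y` lie in DIFFERENT `2 × 2`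
plaquettes `{2m, 2m+1}²`), verbatim the comap in the route's `let Hb`. -/
local notation "Πpl" => (SimpleGraph.comap (fun (x : FermionTorus 2 4) (i : Fin 2) => (ofLex x i : ℕ) / 2)
  (⊤ : SimpleGraph (Fin 2 → ℕ)))

/-- `g13F` is an involution. [folklore] -/
theorem g13_involutive : Function.Involutive g13F := by
  unfold Function.Involutive; decide

/-- `g24F` is an involution. [folklore] -/
theorem g24_involutive : Function.Involutive g24F := by
  unfold Function.Involutive; decide

/-- The two swaps as site permutations. -/
local notation "g13" => Function.Involutive.toPerm g13F g13_involutive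
local notation "g24" => Function.Involutive.toPerm g24F g24_involutive

/-- `g13` is an automorphism of the INTRA-plaquette bond graph. [cite: TsaiYaoLauchliKivelson2008, p. 5] -/
theorem g13_adj_intra_iff : ∀ x y : FermionTorus 2 4,
    (fermionTorusGraph 2 4 \ Πpl).Adj (g13 x) (g13 y) ↔ (fermionTorusGraph 2 4 \ Πpl).Adj x y := by
  decide

/-- `g13` is an automorphism of the INTER-plaquette bond graph. [cite: TsaiYaoLauchliKivelson2008, p. 5] -/
theorem g13_adj_inter_iff : ∀ x y : FermionTorus 2 4,
    (fermionTorusGraph 2 4 ⊓ Πpl).Adj (g13 x) (g13 y) ↔ (fermionTorusGraph 2 4 ⊓ Πpl).Adj x y := by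
  decide

/-- `g24` is an automorphism of the intra-plaquette bond graph. [cite: TsaiYaoLauchliKivelson2008, p. 5] -/
theorem g24_adj_intra_iff : ∀ x y : FermionTorus 2 4,
    (fermionTorusGraph 2 4 \ Πpl).Adj (g24 x) (g24 y) ↔ (fermionTorusGraph 2 4 \ Πpl).Adj x y := by
  decide

/-- `g24` is an automorphism of the inter-plaquette bond graph. [cite: TsaiYaoLauchliKivelson2008, p. 5] -/
theorem g24_adj_inter_iff : ∀ x y : FermionTorus 2 4,
    (fermionTorusGraph 2 4 ⊓ Πpl).Adj (g24 x) (g24 y) ↔ (fermionTorusGraph 2 4 ⊓ Πpl).Adj x y := by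
  decide

/-- `g13` exchanges the two inter-plaquette bond classes: `X₁ ↦ Y₁`. [folklore] -/
theorem g13_map_X₁ : Finset.map (Equiv.toEmbedding (Equiv.prodCongr g13 g13)) X₁ = Y₁ := by decide

/-- `g13` fixes the `x`-intra class. [folklore] -/
theorem g13_map_X₂ : Finset.map (Equiv.toEmbedding (Equiv.prodCongr g13 g13)) X₂ = X₂ := by decide

/-- `g13` fixes the `y`-intra class. [folklore] -/
theorem g13_map_Y₂ : Finset.map (Equiv.toEmbedding (Equiv.prodCongr g13 g13)) Y₂ = Y₂ := by decide

/-- `g24` fixes the `x`-inter class. [folklore] -/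
theorem g24_map_X₁ : Finset.map (Equiv.toEmbedding (Equiv.prodCongr g24 g24)) X₁ = X₁ := by decide

/-- `g24` exchanges the two intra-plaquette bond classes: `X₂ ↦ Y₂`. [folklore] -/
theorem g24_map_X₂ : Finset.map (Equiv.toEmbedding (Equiv.prodCongr g24 g24)) X₂ = Y₂ := by decide

/-- `g24` fixes the `y`-inter class. [folklore] -/
theorem g24_map_Y₁ : Finset.map (Equiv.toEmbedding (Equiv.prodCongr g24 g24)) Y₁ = Y₁ := by decide

/-- **The breathing family of side `4` is invariant under `g13`** (every `a, b, U`).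
[cite: TsaiYaoLauchliKivelson2008, p. 5] -/
theorem relabel_g13_breathing_four (a b U : ℝ) :
    relabel (Orb.mapEquiv g13)
        (hamiltonian (fermionTorusGraph 2 4 \ Πpl) a U + hamiltonian (fermionTorusGraph 2 4 ⊓ Πpl) b 0) =
      hamiltonian (fermionTorusGraph 2 4 \ Πpl) a U + hamiltonian (fermionTorusGraph 2 4 ⊓ Πpl) b 0 := by
  rw [relabel_add, relabel_hamiltonian _ _ g13 g13_adj_intra_iff,
    relabel_hamiltonian _ _ g13 g13_adj_inter_iff]

/-- **The breathing family of side `4` is invariant under `g24`** (every `a, b, U`).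
[cite: TsaiYaoLauchliKivelson2008, p. 5] -/
theorem relabel_g24_breathing_four (a b U : ℝ) :
    relabel (Orb.mapEquiv g24)
        (hamiltonian (fermionTorusGraph 2 4 \ Πpl) a U + hamiltonian (fermionTorusGraph 2 4 ⊓ Πpl) b 0) =
      hamiltonian (fermionTorusGraph 2 4 \ Πpl) a U + hamiltonian (fermionTorusGraph 2 4 ⊓ Πpl) b 0 := by
  rw [relabel_add, relabel_hamiltonian _ _ g24 g24_adj_intra_iff,
    relabel_hamiltonian _ _ g24 g24_adj_inter_iff]

/-- **The weak-bond / strong-bond dichotomy (any `g13`-, `g24`-invariant Hamiltonian of the `4 × 4`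
torus).** If `H` is invariant under both swaps and `φ₀`, `φ₂` are floor vectors of two NON-DEGENERATE
sector floors of `H` with non-vanishing uniform `d_{x²-y²}` amplitude `⟨φ₂, Δ_d φ₀⟩ ≠ 0`, then either
both intra-plaquette class amplitudes vanish or both inter-plaquette ones do: the class amplitudes
`F_i = ⟨φ₂, D_i φ₀⟩` transform by scalars under `(1 3)` and `(2 4)`
(`dotProduct_mulVec_eq_of_fockRelabel_eigen`), `Δ_d = (1/√2)((D₁ + D₂) - (D₃ + D₄))`
(`pairField_dWave_four_eq`), and `dWave_bondClass_dichotomy_of_relations` applies.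
[cite: TsaiYaoLauchliKivelson2008, p. 5, Fig. 7] -/
theorem dWave_bondClass_dichotomy
    {H : Matrix (Finset (Orb (FermionTorus 2 4))) (Finset (Orb (FermionTorus 2 4))) ℂ}
    (h13 : relabel (Orb.mapEquiv g13) H = H) (h24 : relabel (Orb.mapEquiv g24) H = H)
    {N₀ N₂ : ℕ} {M₀ M₂ : ℝ} {φ₀ φ₂ : Fock (Orb (FermionTorus 2 4))}
    (huniq₀ : ∀ φ φ', IsGroundStateInSector H N₀ M₀ φ → IsGroundStateInSector H N₀ M₀ φ' →
      ∃ c : ℂ, φ' = c • φ)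
    (huniq₂ : ∀ φ φ', IsGroundStateInSector H N₂ M₂ φ → IsGroundStateInSector H N₂ M₂ φ' →
      ∃ c : ℂ, φ' = c • φ)
    (h₀ : IsGroundStateInSector H N₀ M₀ φ₀) (h₂ : IsGroundStateInSector H N₂ M₂ φ₂)
    (hT : star φ₂ ⬝ᵥ (pairField dWaveFormFactor 4 *ᵥ φ₀) ≠ 0) :
    (star φ₂ ⬝ᵥ ((∑ p ∈ X₂, bond (Prod.fst p) (Prod.snd p)) *ᵥ φ₀) = 0 ∧
        star φ₂ ⬝ᵥ ((∑ p ∈ Y₂, bond (Prod.fst p) (Prod.snd p)) *ᵥ φ₀) = 0) ∨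
      (star φ₂ ⬝ᵥ ((∑ p ∈ X₁, bond (Prod.fst p) (Prod.snd p)) *ᵥ φ₀) = 0 ∧
        star φ₂ ⬝ᵥ ((∑ p ∈ Y₁, bond (Prod.fst p) (Prod.snd p)) *ᵥ φ₀) = 0) := by
  -- the two floors are eigenvectors of both swaps
  obtain ⟨l1, hl1⟩ := exists_eigenvalue_of_groundStates_smul huniq₀
    (fun φ hφ => hφ.fockRelabel_mapEquiv_mulVec g13 h13) h₀
  obtain ⟨m1, hm1⟩ := exists_eigenvalue_of_groundStates_smul huniq₂
    (fun φ hφ => hφ.fockRelabel_mapEquiv_mulVec g13 h13) h₂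
  obtain ⟨l2, hl2⟩ := exists_eigenvalue_of_groundStates_smul huniq₀
    (fun φ hφ => hφ.fockRelabel_mapEquiv_mulVec g24 h24) h₀
  obtain ⟨m2, hm2⟩ := exists_eigenvalue_of_groundStates_smul huniq₂
    (fun φ hφ => hφ.fockRelabel_mapEquiv_mulVec g24 h24) h₂
  -- transformation laws of the class amplitudes
  have a1 := dotProduct_mulVec_eq_of_fockRelabel_eigen (Orb.mapEquiv g13)
    (∑ p ∈ X₁, bond (Prod.fst p) (Prod.snd p)) hl1 hm1
  have a2 := dotProduct_mulVec_eq_of_fockRelabel_eigen (Orb.mapEquiv g13)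
    (∑ p ∈ X₂, bond (Prod.fst p) (Prod.snd p)) hl1 hm1
  have a4 := dotProduct_mulVec_eq_of_fockRelabel_eigen (Orb.mapEquiv g13)
    (∑ p ∈ Y₂, bond (Prod.fst p) (Prod.snd p)) hl1 hm1
  have b1 := dotProduct_mulVec_eq_of_fockRelabel_eigen (Orb.mapEquiv g24)
    (∑ p ∈ X₁, bond (Prod.fst p) (Prod.snd p)) hl2 hm2
  have b2 := dotProduct_mulVec_eq_of_fockRelabel_eigen (Orb.mapEquiv g24)
    (∑ p ∈ X₂, bond (Prod.fst p) (Prod.snd p)) hl2 hm2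
  have b3 := dotProduct_mulVec_eq_of_fockRelabel_eigen (Orb.mapEquiv g24)
    (∑ p ∈ Y₁, bond (Prod.fst p) (Prod.snd p)) hl2 hm2
  rw [relabel_mapEquiv_sum_bond] at a1 a2 a4 b1 b2 b3
  rw [g13_map_X₁] at a1; rw [g13_map_X₂] at a2; rw [g13_map_Y₂] at a4
  rw [g24_map_X₁] at b1; rw [g24_map_X₂] at b2; rw [g24_map_Y₁] at b3
  -- the uniform `d`-wave amplitude in the class amplitudes
  have hT' : star φ₂ ⬝ᵥ ((∑ p ∈ X₁, bond (Prod.fst p) (Prod.snd p)) *ᵥ φ₀) +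
        star φ₂ ⬝ᵥ ((∑ p ∈ X₂, bond (Prod.fst p) (Prod.snd p)) *ᵥ φ₀) -
        star φ₂ ⬝ᵥ ((∑ p ∈ Y₁, bond (Prod.fst p) (Prod.snd p)) *ᵥ φ₀) -
        star φ₂ ⬝ᵥ ((∑ p ∈ Y₂, bond (Prod.fst p) (Prod.snd p)) *ᵥ φ₀) ≠ 0 := by
    intro h0
    apply hT
    rw [pairField_dWave_four_eq, smul_mulVec, dotProduct_smul, sub_mulVec, add_mulVec, add_mulVec,
      dotProduct_sub, dotProduct_add, dotProduct_add]
    rw [show ∀ A B C D : ℂ, A + B - (C + D) = A + B - C - D from fun A B C D => by ring, h0, smul_zero]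
  exact dWave_bondClass_dichotomy_of_relations a1 a2 a4 b1 b2 b3 hT'

/-- **The dichotomy on the breathing family `H_4(a,b,U)` (every `a, b, U`), floors `(16,0)` and
`(14,0)`**: whenever both floors are non-degenerate and the uniform `d`-wave amplitude between their
vectors is nonzero, either both intra-plaquette (strong-bond) class amplitudes vanish or both
inter-plaquette (weak-bond) ones do — the exact form of `|Δ_w|/|Δ_s| ∼ 10⁻⁷` of the 4 × 4
checkerboard lattice. [cite: TsaiYaoLauchliKivelson2008, p. 5, Fig. 7] -/
theorem breathing_four_dWave_bondClass_dichotomy (a b U : ℝ)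
    {φ₀ φ₂ : Fock (Orb (FermionTorus 2 4))}
    (huniq₀ : ∀ φ φ', IsGroundStateInSector
        (hamiltonian (fermionTorusGraph 2 4 \ Πpl) a U + hamiltonian (fermionTorusGraph 2 4 ⊓ Πpl) b 0)
        (4 ^ 2) 0 φ →
      IsGroundStateInSector
        (hamiltonian (fermionTorusGraph 2 4 \ Πpl) a U + hamiltonian (fermionTorusGraph 2 4 ⊓ Πpl) b 0)
        (4 ^ 2) 0 φ' → ∃ c : ℂ, φ' = c • φ)
    (huniq₂ : ∀ φ φ', IsGroundStateInSector
        (hamiltonian (fermionTorusGraph 2 4 \ Πpl) a U + hamiltonian (fermionTorusGraph 2 4 ⊓ Πpl) b 0)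
        (4 ^ 2 - 2) 0 φ →
      IsGroundStateInSector
        (hamiltonian (fermionTorusGraph 2 4 \ Πpl) a U + hamiltonian (fermionTorusGraph 2 4 ⊓ Πpl) b 0)
        (4 ^ 2 - 2) 0 φ' → ∃ c : ℂ, φ' = c • φ)
    (h₀ : IsGroundStateInSector
        (hamiltonian (fermionTorusGraph 2 4 \ Πpl) a U + hamiltonian (fermionTorusGraph 2 4 ⊓ Πpl) b 0)
        (4 ^ 2) 0 φ₀)
    (h₂ : IsGroundStateInSector
        (hamiltonian (fermionTorusGraph 2 4 \ Πpl) a U + hamiltonian (fermionTorusGraph 2 4 ⊓ Πpl) b 0)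
        (4 ^ 2 - 2) 0 φ₂)
    (hT : star φ₂ ⬝ᵥ (pairField dWaveFormFactor 4 *ᵥ φ₀) ≠ 0) :
    (star φ₂ ⬝ᵥ ((∑ p ∈ X₂, bond (Prod.fst p) (Prod.snd p)) *ᵥ φ₀) = 0 ∧
        star φ₂ ⬝ᵥ ((∑ p ∈ Y₂, bond (Prod.fst p) (Prod.snd p)) *ᵥ φ₀) = 0) ∨
      (star φ₂ ⬝ᵥ ((∑ p ∈ X₁, bond (Prod.fst p) (Prod.snd p)) *ᵥ φ₀) = 0 ∧
        star φ₂ ⬝ᵥ ((∑ p ∈ Y₁, bond (Prod.fst p) (Prod.snd p)) *ᵥ φ₀) = 0) :=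
  dWave_bondClass_dichotomy (relabel_g13_breathing_four a b U) (relabel_g24_breathing_four a b U)
    huniq₀ huniq₂ h₀ h₂ hT

/-- **Under the route's package at side `4` of the breathing family** (written out; `z > 0`): the
floor vectors of the `(16,0)` and `(14,0)` sectors of `H_4(a,b,U)` obey the weak-bond / strong-bond
dichotomy (both floors are non-degenerate — the half-filled one by clause (c),
`halfFilled_groundStates_smul_of_cooperPackage` — and the amplitude is nonzero by clause (c)).
[cite: TsaiYaoLauchliKivelson2008, p. 5, Fig. 7] -/
theorem cooperPackage_breathing_four_bondClass_dichotomy (a b U ε : ℝ) {z : ℝ} (hz : 0 < z)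
    (hCP : (hamiltonian (fermionTorusGraph 2 4 \ Πpl) a U +
            hamiltonian (fermionTorusGraph 2 4 ⊓ Πpl) b 0).minEnergyOn (szSector (4 ^ 2 - 2) 0) +
          (hamiltonian (fermionTorusGraph 2 4 \ Πpl) a U +
            hamiltonian (fermionTorusGraph 2 4 ⊓ Πpl) b 0).minEnergyOn (szSector (4 ^ 2) 0) + ε ≤
        2 * (hamiltonian (fermionTorusGraph 2 4 \ Πpl) a U +
            hamiltonian (fermionTorusGraph 2 4 ⊓ Πpl) b 0).minEnergyOn (szSector (4 ^ 2 - 1) (1 / 2)) ∧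
      (∀ φ₁ φ₂, IsGroundStateInSector (hamiltonian (fermionTorusGraph 2 4 \ Πpl) a U +
            hamiltonian (fermionTorusGraph 2 4 ⊓ Πpl) b 0) (4 ^ 2 - 2) 0 φ₁ →
        IsGroundStateInSector (hamiltonian (fermionTorusGraph 2 4 \ Πpl) a U +
            hamiltonian (fermionTorusGraph 2 4 ⊓ Πpl) b 0) (4 ^ 2 - 2) 0 φ₂ → ∃ c : ℂ, φ₂ = c • φ₁) ∧
      (∀ φ₀ φ₂, IsGroundStateInSector (hamiltonian (fermionTorusGraph 2 4 \ Πpl) a U +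
            hamiltonian (fermionTorusGraph 2 4 ⊓ Πpl) b 0) (4 ^ 2) 0 φ₀ →
        IsGroundStateInSector (hamiltonian (fermionTorusGraph 2 4 \ Πpl) a U +
            hamiltonian (fermionTorusGraph 2 4 ⊓ Πpl) b 0) (4 ^ 2 - 2) 0 φ₂ →
          z * ((4 : ℕ) : ℝ) ^ 2 * (star φ₀ ⬝ᵥ φ₀).re * (star φ₂ ⬝ᵥ φ₂).re ≤
            ‖star φ₂ ⬝ᵥ (pairField dWaveFormFactor 4 *ᵥ φ₀)‖ ^ 2))
    {φ₀ φ₂ : Fock (Orb (FermionTorus 2 4))}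
    (h₀ : IsGroundStateInSector (hamiltonian (fermionTorusGraph 2 4 \ Πpl) a U +
        hamiltonian (fermionTorusGraph 2 4 ⊓ Πpl) b 0) (4 ^ 2) 0 φ₀)
    (h₂ : IsGroundStateInSector (hamiltonian (fermionTorusGraph 2 4 \ Πpl) a U +
        hamiltonian (fermionTorusGraph 2 4 ⊓ Πpl) b 0) (4 ^ 2 - 2) 0 φ₂) :
    (star φ₂ ⬝ᵥ ((∑ p ∈ X₂, bond (Prod.fst p) (Prod.snd p)) *ᵥ φ₀) = 0 ∧
        star φ₂ ⬝ᵥ ((∑ p ∈ Y₂, bond (Prod.fst p) (Prod.snd p)) *ᵥ φ₀) = 0) ∨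
      (star φ₂ ⬝ᵥ ((∑ p ∈ X₁, bond (Prod.fst p) (Prod.snd p)) *ᵥ φ₀) = 0 ∧
        star φ₂ ⬝ᵥ ((∑ p ∈ Y₁, bond (Prod.fst p) (Prod.snd p)) *ᵥ φ₀) = 0) := by
  obtain ⟨-, huniq₂, hamp⟩ := hCP
  have huniq₀ := halfFilled_groundStates_smul_of_cooperPackage (L := 4) hz h₂ hamp
  have hT : star φ₂ ⬝ᵥ (pairField dWaveFormFactor 4 *ᵥ φ₀) ≠ 0 := by
    intro h
    have h1 := hamp φ₀ φ₂ h₀ h₂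
    rw [h, norm_zero, zero_pow two_ne_zero] at h1
    have hpos₀ : 0 < (star φ₀ ⬝ᵥ φ₀).re :=
      (Complex.pos_iff.1 (dotProduct_star_self_pos_iff.2 h₀.2.1)).1
    have hpos₂ : 0 < (star φ₂ ⬝ᵥ φ₂).re :=
      (Complex.pos_iff.1 (dotProduct_star_self_pos_iff.2 h₂.2.1)).1
    have : 0 < z * ((4 : ℕ) : ℝ) ^ 2 * (star φ₀ ⬝ᵥ φ₀).re * (star φ₂ ⬝ᵥ φ₂).re := by positivity
    linarith
  exact breathing_four_dWave_bondClass_dichotomy a b U huniq₀ huniq₂ h₀ h₂ hT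

end Breathing

/-! ### The registered sub-goal stub (verbatim signature, notation expanded) -/

/-- **Registered sub-goal stub `cooperPackage_breathing_four_bondClass_dichotomy_stub`**: under the
route's package with `z > 0` at side `4` of the breathing family (the route's `Hb 4 a b U` written
out), the floor vectors obey the weak-bond / strong-bond dichotomy.
(`cooperPackage_breathing_four_bondClass_dichotomy` with the local notation expanded.)
[cite: TsaiYaoLauchliKivelson2008, p. 5, Fig. 7] -/
theorem cooperPackage_breathing_four_bondClass_dichotomy_stub : ∀ (a b U ε : ℝ) {z : ℝ}, 0 < z → ((hamiltonian (fermionTorusGraph 2 4 \ (SimpleGraph.comap (fun (x : FermionTorus 2 4) (i : Fin 2) => (ofLex x i : ℕ) / 2) (⊤ : SimpleGraph (Fin 2 → ℕ)))) a U + hamiltonian (fermionTorusGraph 2 4 ⊓ (SimpleGraph.comap (fun (x : FermionTorus 2 4) (i : Fin 2) => (ofLex x i : ℕ) / 2) (⊤ : SimpleGraph (Fin 2 → ℕ)))) b 0).minEnergyOn (szSector (4 ^ 2 - 2) 0) + (hamiltonian (fermionTorusGraph 2 4 \ (SimpleGraph.comap (fun (x : FermionTorus 2 4) (i : Fin 2)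 => (ofLex x i : ℕ) / 2) (⊤ : SimpleGraph (Fin 2 → ℕ)))) a U + hamiltonian (fermionTorusGraph 2 4 ⊓ (SimpleGraph.comap (fun (x : FermionTorus 2 4) (i : Fin 2) => (ofLex x i : ℕ) / 2) (⊤ : SimpleGraph (Fin 2 → ℕ)))) b 0).minEnergyOn (szSector (4 ^ 2) 0) + ε ≤ 2 * (hamiltonian (fermionTorusGraph 2 4 \ (SimpleGraph.comap (fun (x : FermionTorus 2 4) (i : Fin 2) => (ofLex x i : ℕ) / 2) (⊤ : SimpleGraph (Fin 2 → ℕ)))) a U + hamiltonian (fermionTorusGraph 2 4 ⊓ (SimpleGraph.comap (fun (x : FermionTorus 2 4) (i : Fin 2) => (ofLex x i : ℕ) / 2) (⊤ : SimpleGraph (Fin 2 → ℕ)))) b 0).minEnergyOn (szSector (4 ^ 2 - 1) (1 / 2)) ∧ (∀ φ₁ φ₂, IsGroundStateInSector (hamiltonian (fermionTorusGraph 2 4 \ (SimpleGraph.comap (fun (x : FermionTorus 2 4) (i : Fin 2) => (ofLex x i : ℕ) / 2) (⊤ : SimpleGraph (Fin 2 → ℕ)))) a U + hamiltonian (fermionTorusGraph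 2 4 ⊓ (SimpleGraph.comap (fun (x : FermionTorus 2 4) (i : Fin 2) => (ofLex x i : ℕ) / 2) (⊤ : SimpleGraph (Fin 2 → ℕ)))) b 0) (4 ^ 2 - 2) 0 φ₁ → IsGroundStateInSector (hamiltonian (fermionTorusGraph 2 4 \ (SimpleGraph.comap (fun (x : FermionTorus 2 4) (i : Fin 2) => (ofLex x i : ℕ) / 2) (⊤ : SimpleGraph (Fin 2 → ℕ)))) a U + hamiltonian (fermionTorusGraph 2 4 ⊓ (SimpleGraph.comap (fun (x : FermionTorus 2 4) (i : Fin 2) => (ofLex x i : ℕ) / 2) (⊤ : SimpleGraph (Fin 2 → ℕ)))) b 0) (4 ^ 2 - 2) 0 φ₂ → ∃ c : ℂ, φ₂ = c • φ₁) ∧ (∀ φ₀ φ₂, IsGroundStateInSector (hamiltonian (fermionTorusGraph 2 4 \ (SimpleGraph.comap (fun (x : FermionTorus 2 4) (i : Fin 2) => (ofLex x i : ℕ) / 2) (⊤ : SimpleGraph (Fin 2 → ℕ)))) a U + hamiltonian (fermionTorusGraph 2 4 ⊓ (SimpleGraph.comap (fun (x : FermionTorus 2 4) (i : Fin 2) =>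 (ofLex x i : ℕ) / 2) (⊤ : SimpleGraph (Fin 2 → ℕ)))) b 0) (4 ^ 2) 0 φ₀ → IsGroundStateInSector (hamiltonian (fermionTorusGraph 2 4 \ (SimpleGraph.comap (fun (x : FermionTorus 2 4) (i : Fin 2) => (ofLex x i : ℕ) / 2) (⊤ : SimpleGraph (Fin 2 → ℕ)))) a U + hamiltonian (fermionTorusGraph 2 4 ⊓ (SimpleGraph.comap (fun (x : FermionTorus 2 4) (i : Fin 2) => (ofLex x i : ℕ) / 2) (⊤ : SimpleGraph (Fin 2 → ℕ)))) b 0) (4 ^ 2 - 2) 0 φ₂ → z * ((4 : ℕ) : ℝ) ^ 2 * (star φ₀ ⬝ᵥ φ₀).re * (star φ₂ ⬝ᵥ φ₂).re ≤ ‖star φ₂ ⬝ᵥ (pairField dWaveFormFactor 4 *ᵥ φ₀)‖ ^ 2)) → ∀ {φ₀ φ₂ : Fock (Orb (FermionTorus 2 4))}, IsGroundStateInSector (hamiltonian (fermionTorusGraph 2 4 \ (SimpleGraph.comap (fun (x : FermionTorus 2 4) (i : Fin 2) => (ofLex x i : ℕ) / 2) (⊤ : SimpleGraph (Fin 2 →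 ℕ)))) a U + hamiltonian (fermionTorusGraph 2 4 ⊓ (SimpleGraph.comap (fun (x : FermionTorus 2 4) (i : Fin 2) => (ofLex x i : ℕ) / 2) (⊤ : SimpleGraph (Fin 2 → ℕ)))) b 0) (4 ^ 2) 0 φ₀ → IsGroundStateInSector (hamiltonian (fermionTorusGraph 2 4 \ (SimpleGraph.comap (fun (x : FermionTorus 2 4) (i : Fin 2) => (ofLex x i : ℕ) / 2) (⊤ : SimpleGraph (Fin 2 → ℕ)))) a U + hamiltonian (fermionTorusGraph 2 4 ⊓ (SimpleGraph.comap (fun (x : FermionTorus 2 4) (i : Fin 2) => (ofLex x i : ℕ) / 2) (⊤ : SimpleGraph (Fin 2 → ℕ)))) b 0) (4 ^ 2 - 2) 0 φ₂ → (star φ₂ ⬝ᵥ ((∑ p ∈ (Finset.univ.filter fun p : FermionTorus 2 4 × FermionTorus 2 4 => ofLex (Prod.fst p) 1 = ofLex (Prod.snd p) 1 ∧ ((ofLex (Prod.fst p) 0 = 0 ∧ ofLex (Prod.snd p) 0 = 1) ∨ (ofLex (Prod.fst p) 0 = 1 ∧ ofLex (Prod.snd p) 0 = 0) ∨ (ofLex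 (Prod.fst p) 0 = 2 ∧ ofLex (Prod.snd p) 0 = 3) ∨ (ofLex (Prod.fst p) 0 = 3 ∧ ofLex (Prod.snd p) 0 = 2))), bond (Prod.fst p) (Prod.snd p)) *ᵥ φ₀) = 0 ∧ star φ₂ ⬝ᵥ ((∑ p ∈ (Finset.univ.filter fun p : FermionTorus 2 4 × FermionTorus 2 4 => ofLex (Prod.fst p) 0 = ofLex (Prod.snd p) 0 ∧ ((ofLex (Prod.fst p) 1 = 0 ∧ ofLex (Prod.snd p) 1 = 1) ∨ (ofLex (Prod.fst p) 1 = 1 ∧ ofLex (Prod.snd p) 1 = 0) ∨ (ofLex (Prod.fst p) 1 = 2 ∧ ofLex (Prod.snd p) 1 = 3) ∨ (ofLex (Prod.fst p) 1 = 3 ∧ ofLex (Prod.snd p) 1 = 2))), bond (Prod.fst p) (Prod.snd p)) *ᵥ φ₀) = 0) ∨ (star φ₂ ⬝ᵥ ((∑ p ∈ (Finset.univ.filter fun p : FermionTorus 2 4 × FermionTorus 2 4 => ofLex (Prod.fst p) 1 = ofLex (Prod.snd p) 1 ∧ ((ofLex (Prod.fst p) 0 = 1 ∧ ofLex (Prod.snd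 p) 0 = 2) ∨ (ofLex (Prod.fst p) 0 = 2 ∧ ofLex (Prod.snd p) 0 = 1) ∨ (ofLex (Prod.fst p) 0 = 3 ∧ ofLex (Prod.snd p) 0 = 0) ∨ (ofLex (Prod.fst p) 0 = 0 ∧ ofLex (Prod.snd p) 0 = 3))), bond (Prod.fst p) (Prod.snd p)) *ᵥ φ₀) = 0 ∧ star φ₂ ⬝ᵥ ((∑ p ∈ (Finset.univ.filter fun p : FermionTorus 2 4 × FermionTorus 2 4 => ofLex (Prod.fst p) 0 = ofLex (Prod.snd p) 0 ∧ ((ofLex (Prod.fst p) 1 = 1 ∧ ofLex (Prod.snd p) 1 = 2) ∨ (ofLex (Prod.fst p) 1 = 2 ∧ ofLex (Prod.snd p) 1 = 1) ∨ (ofLex (Prod.fst p) 1 = 3 ∧ ofLex (Prod.snd p) 1 = 0) ∨ (ofLex (Prod.fst p) 1 = 0 ∧ ofLex (Prod.snd p) 1 = 3))), bond (Prod.fst p) (Prod.snd p)) *ᵥ φ₀) = 0) :=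
  fun a b U ε _ hz hCP _ _ h₀ h₂ => cooperPackage_breathing_four_bondClass_dichotomy a b U ε hz hCP h₀ h₂

/-- **Registered sub-goal stub `relabel_g13_breathing_four_stub`**: the breathing family of side `4`
(the route's `Hb 4 a b U` written out) is invariant under the hidden hypercube swap `g13`
(`x`-inter ↔ `y`-inter directions), for every `a, b, U` (`relabel_g13_breathing_four` with the local
notation expanded). [cite: TsaiYaoLauchliKivelson2008, p. 5] -/
theorem relabel_g13_breathing_four_stub : ∀ (a b U : ℝ), relabel (Orb.mapEquiv (Function.Involutive.toPerm (fun x : FermionTorus 2 4 => toLex ![(![![0, 0, 3, 3], ![1, 1, 2, 2], ![1, 1, 2, 2], ![0, 0, 3, 3]] : Fin 4 → Fin 4 → Fin 4) (ofLex x 0) (ofLex x 1), (![![0, 1, 1, 0], ![0, 1, 1, 0], ![3, 2, 2, 3], ![3, 2, 2, 3]] : Fin 4 → Fin 4 → Fin 4) (ofLex x 0) (ofLex x 1)]) g13_involutive)) (hamiltonian (fermionTorusGraph 2 4 \ (SimpleGraph.comap (fun (x : FermionTorus 2 4) (i : Fin 2) => (ofLex x i : ℕ) / 2) (⊤ : SimpleGraph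 (Fin 2 → ℕ)))) a U + hamiltonian (fermionTorusGraph 2 4 ⊓ (SimpleGraph.comap (fun (x : FermionTorus 2 4) (i : Fin 2) => (ofLex x i : ℕ) / 2) (⊤ : SimpleGraph (Fin 2 → ℕ)))) b 0) = (hamiltonian (fermionTorusGraph 2 4 \ (SimpleGraph.comap (fun (x : FermionTorus 2 4) (i : Fin 2) => (ofLex x i : ℕ) / 2) (⊤ : SimpleGraph (Fin 2 → ℕ)))) a U + hamiltonian (fermionTorusGraph 2 4 ⊓ (SimpleGraph.comap (fun (x : FermionTorus 2 4) (i : Fin 2) => (ofLex x i : ℕ) / 2) (⊤ : SimpleGraph (Fin 2 → ℕ)))) b 0) :=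
  fun a b U => relabel_g13_breathing_four a b U

end Summit.HubbardSuperconductivity.HubbardSuperconductivity.Theorems.CooperPairDMottWalk

end
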